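import Mathlib
import Summits.KontsevichZagierPeriods.Zeta5Search.BrickHoleWeight
import Summits.KontsevichZagierPeriods.Zeta5Search.BrickHoleConst
import Summits.KontsevichZagierPeriods.Zeta5Search.BrickHatReduction
import Summits.KontsevichZagierPeriods.Zeta5Search.BrickLevelReduction

/-!
# BrickLevelReductionInf — zi-p2's THEOREM 10 (iii)/(iv) in the tree's form: the one-level REDUCTION of a row
`n = n₀ + Np` of either kernel WITHOUT the hypothesis `L + 1 ≤ A`: the ° cells reduce to the row `N` (block weight
`W`), the HOLE cells to the row `N − 1` (hole weight `G`, `p^A ∣ G`) — nothing is discarded termwise (cell zeta5-irr)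

HONEST FRAMING: systematic search; no irrationality claim unless certified. INSTRUMENT lemmas of the ζ(5)
census cell zeta5-irr (HOME `run/shared/lean/pub/zeta5-irr/`; memo `zi-p2/probes/B8/thm10/THEOREM10.md` (sealed
eeb9a92811d678e0) §2 «(iii) REDUCTION (no level hypothesis). For every s ∈ {0} ∪ [1,A] and every block 0 ≤ K′ ≤ N′ − 1:
Σ_{K hole in block K′} g(K)·r_K^{(s)}(N) = p^A·Σ_{cl} p^{B|ε|+c}·W^{cl}_g(K′)·ȓ^{cl(s)}_{K′}(N′) + E_{K′}^{(s)}, v(E) ≥ A + Λ»,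
LEMMA 10.4/10.5, and the proof of (v): «THEOREM8's proof of H°, step (1) («holes, termwise», the ONLY place where
ℓ ≤ A … was used) is replaced by (1^∞)»). In the NOMINAL-LEVEL vocabulary of `BrickLevelReduction` the hole cells of
`n = n₀ + (m+1)p` land on the row `m` at the same nominal level `L` as the ° cells' row `m + 1`, weighted by
`BrickHoleWeight.holeWeight` (which carries `p^A`), with an error of valuation `≥ A + L ≥ L + 1`. Nothing here is about
ζ(5); no irrationality content; filing moves no rung. Filed by the engine seat zi-eng (g10); inputs `BrickHoleStrip`
(hole = hat), `BrickHoleConst` (`v(a) ≥ A`), `BrickHatReduction.twoScale_depth/_zero` (generic two-scale lemmas),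
`BrickLevelReduction` (digit split, centre), `BrickResidueLawCirc` (° cells).

## The statements (`p` odd prime, `1 ≤ B`, `2B ≤ A`, `ε ≤ 1`, `n = n₀ + Np`, `n₀ < p`, `N < p^{L+1}`; NO `L + 1 ≤ A`)

* `hole_cell_le`, `hole_cellZero_le`: a hole cell `k = k₀ + Kp` (`n₀ < k₀ < p`, off the exact centre) of
  `n = n₀ + (m+1)p` against its main term: `v(g·p^{(L+1)d}[T^d]F_k − g·μ_k·p^{Ld}[T^d]F̃_K^{(m)}) ≤ exp(−(A+L))`.
* **`level_reduction_inf`**, **`level_reduction_inf_zero`**: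
  `v(Σ_{k≤n} g(k)r_k^{(s)}(n) − Σ_{K≤N} W(K)r̃_K^{(s)}(N) − Σ_{K<N} G(K)r̃_K^{(s)}(N−1)) ≤ exp(−(L+1))`,
  `W = blockWeight`, `G = holeWeight A B ε p n₀ (N−1) g`.
-/

namespace Summit.KontsevichZagierPeriods.Zeta5Search.BrickLevelReductionInf

open Finset Nat Polynomial WithZero
open Summit.KontsevichZagierPeriods.Zeta5Search.BrickTopCoefficient (cTop)
open Summit.KontsevichZagierPeriods.Zeta5Search.BrickLaurent (laurent cell laurent_zero)
open Summit.KontsevichZagierPeriods.Zeta5Search.BrickPartialFractions (cellZero)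
open Summit.KontsevichZagierPeriods.Zeta5Search.BrickLambda (cTop_zero_ne_zero)
open Summit.KontsevichZagierPeriods.Zeta5Search.BrickHarmonicBlocks (hsum)
open Summit.KontsevichZagierPeriods.Zeta5Search.BrickDigitStepDZero (cellZero_eq)
open Summit.KontsevichZagierPeriods.Zeta5Search.BrickResidueLawMain (level_laurent_integral level_hsum_integral)
open Summit.KontsevichZagierPeriods.Zeta5Search.BrickResidueLawCirc (residueLaw_circ residueLaw_circ_zero)
open Summit.KontsevichZagierPeriods.Zeta5Search.BrickLevelReduction (blockWeight cTop_one_centre sum_range_digit_split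
  centre_cell_le centre_cellZero_le row_lt)
open Summit.KontsevichZagierPeriods.Zeta5Search.BrickHatReduction (hatLaurent hatLaurentZero twoScale_depth twoScale_zero
  hatLaurent_main_sub_le hatLaurentZero_main_sub_le)
open Summit.KontsevichZagierPeriods.Zeta5Search.BrickHoleStrip (holePoly laurentSeries_rescale_eq_hole
  padicValuation_holePoly_coeff_le)
open Summit.KontsevichZagierPeriods.Zeta5Search.BrickHoleConst (padicValuation_holeConst_le)
open Summit.KontsevichZagierPeriods.Zeta5Search.BrickHoleWeight (holeWeight)

noncomputable section

variable {p : ℕ} [Fact p.Prime]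

/-! ## A hole cell against its main term -/

section hole

variable (hp2 : p ≠ 2) {A B ε n₀ m K k₀ L : ℕ} (hAB : 2 * B ≤ A) (hε : ε ≤ 1) (hn₀ : n₀ < p) (hm : m < p ^ (L + 1))
  (hK : K ≤ m) (hk₀ : n₀ < k₀) (hk₀p : k₀ < p) (hcen : 2 * (k₀ + K * p) ≠ n₀ + (m + 1) * p ∨ ε = 0)
include hp2 hAB hε hn₀ hm hK hk₀ hk₀p hcen

/-- The hole identity's constant and the multiplier `μ_k = a·holePoly(0)`, with `v(a) ≤ exp(−A)`. -/
theorem hole_data :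
    ∃ U : PowerSeries ℚ, PowerSeries.constantCoeff U = 1 ∧ ScaledSeries.IsSlopeInt p (-1) 0 U ∧ ∃ a : ℚ,
      PowerSeries.rescale (p : ℚ) (BrickLaurent.laurentSeries A B ε (n₀ + (m + 1) * p) (k₀ + K * p)) =
        PowerSeries.C a * BrickLaurent.laurentSeries A B 0 m K *
          ((holePoly B ε p n₀ m k₀ K : ℚ[X]) : PowerSeries ℚ) * U ∧
      cTop A B ε (n₀ + (m + 1) * p) (k₀ + K * p) / cTop A B 0 m K = a * (holePoly B ε p n₀ m k₀ K).eval 0 ∧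
      Rat.padicValuation p a ≤ exp (-(A : ℤ)) := by
  obtain ⟨U, hU0, hUint, a, hid, ha⟩ :=
    laurentSeries_rescale_eq_hole (p := p) hp2 (A := A) (B := B) (ε := ε) (N₀ := n₀) (K₀ := k₀) (m := m) (K' := K)
      hk₀ hk₀p hK
  have hkn : k₀ + K * p ≤ n₀ + (m + 1) * p := by nlinarith
  rw [laurent_zero hAB 0 hK, laurent_zero hAB ε hkn] at ha
  obtain ⟨M, rfl⟩ := Nat.exists_eq_add_of_le hK
  refine ⟨U, hU0, hUint, a, hid, ?_, ?_⟩
  · rw [div_eq_iff (cTop_zero_ne_zero (Nat.le_add_right K M) A B), ← ha]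
  · exact padicValuation_holeConst_le hp2 hAB hε (i := k₀) (i' := n₀ + p - k₀) (by omega) hk₀p (by omega) hn₀ ha hcen

/-- **A hole cell against its main term, every depth**: for `g ∈ ℤ_(p)`,
`v(g·p^{(L+1)d}[T^d]F_k^{(n)} − g·μ_k·p^{Ld}[T^d]F̃_K^{(m)}) ≤ exp(−(A+L))` (`μ_k = c_{k,A}(n)/c̃_{K,A}(m)`). -/
theorem hole_cell_le {g : ℚ} (hg : Rat.padicValuation p g ≤ 1) (d : ℕ) :
    Rat.padicValuation p (g * ((p : ℚ) ^ ((L + 1) * d) * laurent A B ε (n₀ + (m + 1) * p) (k₀ + K * p) d) -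
      g * (cTop A B ε (n₀ + (m + 1) * p) (k₀ + K * p) / cTop A B 0 m K) *
        ((p : ℚ) ^ (L * d) * laurent A B 0 m K d)) ≤ exp (-((A : ℤ) + L)) := by
  obtain ⟨U, hU0, hUint, a, hid, hμ, hva⟩ := hole_data hp2 hAB hε hn₀ hm hK hk₀ hk₀p hcen
  have hE := padicValuation_holePoly_coeff_le hp2 B ε n₀ m k₀ K
  have h1 := twoScale_depth hp2 hAB hm hK hE hU0 hUint hid d
  have h2 := hatLaurent_main_sub_le hp2 hAB hm hK hE d
  rw [hμ, show g * ((p : ℚ) ^ ((L + 1) * d) * laurent A B ε (n₀ + (m + 1) * p) (k₀ + K * p) d) -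
      g * (a * (holePoly B ε p n₀ m k₀ K).eval 0) * ((p : ℚ) ^ (L * d) * laurent A B 0 m K d) =
    g * (((p : ℚ) ^ ((L + 1) * d) * laurent A B ε (n₀ + (m + 1) * p) (k₀ + K * p) d -
        a * ((p : ℚ) ^ (L * d) * hatLaurent A B (holePoly B ε p n₀ m k₀ K) m K d)) +
      a * ((p : ℚ) ^ (L * d) * hatLaurent A B (holePoly B ε p n₀ m k₀ K) m K d -
        (holePoly B ε p n₀ m k₀ K).eval 0 * ((p : ℚ) ^ (L * d) * laurent A B 0 m K d))) by ring, map_mul]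
  refine (mul_le_mul' hg ((Valuation.map_add _ _ _).trans (max_le (h1.trans ?_) ?_))).trans (by rw [one_mul])
  · calc _ ≤ exp (-(A : ℤ)) * exp (-((L : ℤ) + 1)) := mul_le_mul' hva le_rfl
      _ ≤ _ := by rw [← exp_add, exp_le_exp]; omega
  · rw [map_mul]
    calc _ ≤ exp (-(A : ℤ)) * exp (-(L : ℤ)) := mul_le_mul' hva h2
      _ = _ := by rw [← exp_add]; congr 1; ring

/-- **A hole harmonic cell against its main term**:
`v(g·p^{(L+1)A}cell^{(0)}_k(n) − g·μ_k·p^{LA}cell̃^{(0)}_K(m)) ≤ exp(−(A+L))`. -/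
theorem hole_cellZero_le {g : ℚ} (hg : Rat.padicValuation p g ≤ 1) :
    Rat.padicValuation p (g * ((p : ℚ) ^ ((L + 1) * A) * cellZero A B ε (n₀ + (m + 1) * p) (k₀ + K * p)) -
      g * (cTop A B ε (n₀ + (m + 1) * p) (k₀ + K * p) / cTop A B 0 m K) *
        ((p : ℚ) ^ (L * A) * cellZero A B 0 m K)) ≤ exp (-((A : ℤ) + L)) := by
  have hp : p.Prime := Fact.out
  obtain ⟨U, hU0, hUint, a, hid, hμ, hva⟩ := hole_data hp2 hAB hε hn₀ hm hK hk₀ hk₀p hcen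
  have hE := padicValuation_holePoly_coeff_le hp2 B ε n₀ m k₀ K
  have hKJ : (k₀ + K * p) / p = K := by rw [Nat.add_mul_div_right _ _ hp.pos, Nat.div_eq_of_lt hk₀p, zero_add]
  have h1 := twoScale_zero hp2 hAB hm hK hE hU0 hUint hid hKJ
  have h2 := hatLaurentZero_main_sub_le hp2 hAB hm hK hE
  rw [hμ, show g * ((p : ℚ) ^ ((L + 1) * A) * cellZero A B ε (n₀ + (m + 1) * p) (k₀ + K * p)) -
      g * (a * (holePoly B ε p n₀ m k₀ K).eval 0) * ((p : ℚ) ^ (L * A) * cellZero A B 0 m K) =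
    g * (((p : ℚ) ^ ((L + 1) * A) * cellZero A B ε (n₀ + (m + 1) * p) (k₀ + K * p) -
        a * hatLaurentZero A B (holePoly B ε p n₀ m k₀ K) p L m K) +
      a * (hatLaurentZero A B (holePoly B ε p n₀ m k₀ K) p L m K -
        (holePoly B ε p n₀ m k₀ K).eval 0 * ((p : ℚ) ^ (L * A) * cellZero A B 0 m K))) by ring, map_mul]
  refine (mul_le_mul' hg ((Valuation.map_add _ _ _).trans (max_le (h1.trans ?_) ?_))).trans (by rw [one_mul])
  · calc _ ≤ exp (-(A : ℤ)) * exp (-((L : ℤ) + 1)) := mul_le_mul' hva le_rfl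
      _ ≤ _ := by rw [← exp_add, exp_le_exp]; omega
  · rw [map_mul]
    calc _ ≤ exp (-(A : ℤ)) * exp (-(L : ℤ)) := mul_le_mul' hva h2
      _ = _ := by rw [← exp_add]; congr 1; ring

end hole

/-! ## The one-level reduction without level hypothesis -/

section reduction

variable (hp2 : p ≠ 2) {A B ε N n₀ L : ℕ} (hAB : 2 * B ≤ A) (hB : 1 ≤ B) (hε : ε ≤ 1) (hn₀ : n₀ < p)
  (hN : N < p ^ (L + 1)) {g : ℕ → ℚ} (hg : ∀ k, k ≤ n₀ + N * p → Rat.padicValuation p (g k) ≤ 1)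
include hp2 hAB hB hε hn₀ hN hg

/-- **ONE-LEVEL REDUCTION WITHOUT LEVEL HYPOTHESIS, cells `s ≥ 1`**:
`v(Σ_{k≤n} g(k)·p^{(L+1)(A−s)}c_{k,s}(n) − Σ_{K≤N} W(K)·p^{L(A−s)}c̃_{K,s}(N) − Σ_{K<N} G(K)·p^{L(A−s)}c̃_{K,s}(N−1)) ≤ exp(−(L+1))`
(`W = blockWeight`, `G = holeWeight … (N−1) g`): ° cells by the residue law, the centre carries `λ = μ = 0`, hole cells
by the hole = hat identity. -/
theorem level_reduction_inf (s : ℕ) :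
    Rat.padicValuation p (∑ k ∈ range (n₀ + N * p + 1), g k * ((p : ℚ) ^ ((L + 1) * (A - s)) * cell A B ε (n₀ + N * p) k s) -
      ∑ K ∈ range (N + 1), blockWeight A B ε p n₀ N g K * ((p : ℚ) ^ (L * (A - s)) * cell A B 0 N K s) -
      ∑ K ∈ range N, holeWeight A B ε p n₀ (N - 1) g K * ((p : ℚ) ^ (L * (A - s)) * cell A B 0 (N - 1) K s)) ≤
      exp (-((L : ℤ) + 1)) := by
  have hp : p.Prime := Fact.out
  have hn := row_lt (L := L) hn₀ hN
  have hA1 : (A : ℤ) + L ≥ L + 1 := by omega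
  set n := n₀ + N * p with hn_def
  rw [sum_range_digit_split (p := p) _ hn₀ N]
  have hcirc : ∑ k₀ ∈ range (n₀ + 1), ∑ K ∈ range (N + 1),
      g (k₀ + K * p) * ((p : ℚ) ^ ((L + 1) * (A - s)) * cell A B ε n (k₀ + K * p) s) -
      ∑ K ∈ range (N + 1), blockWeight A B ε p n₀ N g K * ((p : ℚ) ^ (L * (A - s)) * cell A B 0 N K s) =
      ∑ k₀ ∈ range (n₀ + 1), ∑ K ∈ range (N + 1), g (k₀ + K * p) *
        ((p : ℚ) ^ ((L + 1) * (A - s)) * cell A B ε n (k₀ + K * p) s -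
          cTop A B ε n (k₀ + K * p) / cTop A B 0 N K * ((p : ℚ) ^ (L * (A - s)) * cell A B 0 N K s)) := by
    simp only [blockWeight, ← hn_def, Finset.sum_mul, mul_sub, Finset.sum_sub_distrib]
    rw [Finset.sum_comm (s := range (N + 1)) (t := range (n₀ + 1))]
    congr 1
    exact Finset.sum_congr rfl fun k₀ _ => Finset.sum_congr rfl fun K _ => by ring
  -- the hole part minus the hole weights, cell by cell
  have hhole : ∑ k₀ ∈ Ico (n₀ + 1) p, ∑ K ∈ range N,
      g (k₀ + K * p) * ((p : ℚ) ^ ((L + 1) * (A - s)) * cell A B ε n (k₀ + K * p) s) -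
      ∑ K ∈ range N, holeWeight A B ε p n₀ (N - 1) g K * ((p : ℚ) ^ (L * (A - s)) * cell A B 0 (N - 1) K s) =
      ∑ k₀ ∈ Ico (n₀ + 1) p, ∑ K ∈ range N, (g (k₀ + K * p) *
        ((p : ℚ) ^ ((L + 1) * (A - s)) * cell A B ε n (k₀ + K * p) s) - g (k₀ + K * p) *
          (cTop A B ε (n₀ + (N - 1 + 1) * p) (k₀ + K * p) / cTop A B 0 (N - 1) K) *
          ((p : ℚ) ^ (L * (A - s)) * cell A B 0 (N - 1) K s)) := by
    simp only [holeWeight, Finset.sum_mul, Finset.sum_sub_distrib]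
    rw [Finset.sum_comm (s := range N) (t := Ico (n₀ + 1) p)]
  rw [show ∀ a b c d : ℚ, a + b - c - d = (a - c) + (b - d) from fun a b c d => by ring, hcirc, hhole]
  refine Valuation.map_add_le _ (Valuation.map_sum_le _ fun k₀ hk₀ => Valuation.map_sum_le _ fun K hK => ?_)
    (Valuation.map_sum_le _ fun k₀ hk₀ => Valuation.map_sum_le _ fun K hK => ?_)
  · -- a ° cell (verbatim from `BrickLevelReduction.level_reduction`)
    have hk₀' := mem_range.1 hk₀
    have hK' := mem_range.1 hK
    have hkn : k₀ + K * p ≤ n := by rw [hn_def]; nlinarith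
    rw [map_mul]
    refine (mul_le_mul' (hg _ hkn) ?_).trans (by rw [one_mul])
    by_cases hc : 2 * (k₀ + K * p) ≠ n ∨ ε = 0
    · exact residueLaw_circ hp2 hAB rfl rfl hN hn₀ (by omega) (by omega) hc
        (div_mul_cancel₀ _ (cTop_zero_ne_zero (by omega) A B)) s
    · have hε1 : ε = 1 := by omega
      have hcen : 2 * (k₀ + K * p) = n := by by_contra h; exact hc (Or.inl h)
      subst hε1
      rw [cTop_one_centre A B hcen, zero_div, zero_mul, sub_zero]
      exact centre_cell_le hp2 hAB hn hkn hcen s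
  · -- a hole cell
    have hk₀' := mem_Ico.1 hk₀
    have hK' := mem_range.1 hK
    obtain ⟨m, rfl⟩ : ∃ m, N = m + 1 := ⟨N - 1, by omega⟩
    rw [Nat.add_sub_cancel] at *
    have hm : m < p ^ (L + 1) := by omega
    have hkn : k₀ + K * p ≤ n := by rw [hn_def]; nlinarith
    by_cases hc : 2 * (k₀ + K * p) ≠ n ∨ ε = 0
    · exact (hole_cell_le hp2 hAB hε hn₀ hm (by omega) (by omega) hk₀'.2 hc (hg _ hkn) (A - s)).trans
        (exp_le_exp.2 (by omega))
    · have hε1 : ε = 1 := by omega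
      have hcen : 2 * (k₀ + K * p) = n := by by_contra h; exact hc (Or.inl h)
      subst hε1
      rw [hn_def] at hcen
      rw [cTop_one_centre A B hcen, zero_div, mul_zero, zero_mul, sub_zero, map_mul]
      exact (mul_le_mul' (hg _ hkn) (centre_cell_le hp2 hAB hn hkn hcen s)).trans (by rw [one_mul])

/-- **ONE-LEVEL REDUCTION WITHOUT LEVEL HYPOTHESIS, harmonic cell `s = 0`**. -/
theorem level_reduction_inf_zero :
    Rat.padicValuation p (∑ k ∈ range (n₀ + N * p + 1), g k * ((p : ℚ) ^ ((L + 1) * A) * cellZero A B ε (n₀ + N * p) k) -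
      ∑ K ∈ range (N + 1), blockWeight A B ε p n₀ N g K * ((p : ℚ) ^ (L * A) * cellZero A B 0 N K) -
      ∑ K ∈ range N, holeWeight A B ε p n₀ (N - 1) g K * ((p : ℚ) ^ (L * A) * cellZero A B 0 (N - 1) K)) ≤
      exp (-((L : ℤ) + 1)) := by
  have hp : p.Prime := Fact.out
  have hn := row_lt (L := L) hn₀ hN
  have hA1 : (A : ℤ) + L ≥ L + 1 := by omega
  set n := n₀ + N * p with hn_def
  rw [sum_range_digit_split (p := p) _ hn₀ N]
  have hcirc : ∑ k₀ ∈ range (n₀ + 1), ∑ K ∈ range (N + 1),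
      g (k₀ + K * p) * ((p : ℚ) ^ ((L + 1) * A) * cellZero A B ε n (k₀ + K * p)) -
      ∑ K ∈ range (N + 1), blockWeight A B ε p n₀ N g K * ((p : ℚ) ^ (L * A) * cellZero A B 0 N K) =
      ∑ k₀ ∈ range (n₀ + 1), ∑ K ∈ range (N + 1), g (k₀ + K * p) *
        ((p : ℚ) ^ ((L + 1) * A) * cellZero A B ε n (k₀ + K * p) -
          cTop A B ε n (k₀ + K * p) / cTop A B 0 N K * ((p : ℚ) ^ (L * A) * cellZero A B 0 N K)) := by
    simp only [blockWeight, ← hn_def, Finset.sum_mul, mul_sub, Finset.sum_sub_distrib]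
    rw [Finset.sum_comm (s := range (N + 1)) (t := range (n₀ + 1))]
    congr 1
    exact Finset.sum_congr rfl fun k₀ _ => Finset.sum_congr rfl fun K _ => by ring
  have hhole : ∑ k₀ ∈ Ico (n₀ + 1) p, ∑ K ∈ range N,
      g (k₀ + K * p) * ((p : ℚ) ^ ((L + 1) * A) * cellZero A B ε n (k₀ + K * p)) -
      ∑ K ∈ range N, holeWeight A B ε p n₀ (N - 1) g K * ((p : ℚ) ^ (L * A) * cellZero A B 0 (N - 1) K) =
      ∑ k₀ ∈ Ico (n₀ + 1) p, ∑ K ∈ range N, (g (k₀ + K * p) *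
        ((p : ℚ) ^ ((L + 1) * A) * cellZero A B ε n (k₀ + K * p)) - g (k₀ + K * p) *
          (cTop A B ε (n₀ + (N - 1 + 1) * p) (k₀ + K * p) / cTop A B 0 (N - 1) K) *
          ((p : ℚ) ^ (L * A) * cellZero A B 0 (N - 1) K)) := by
    simp only [holeWeight, Finset.sum_mul, Finset.sum_sub_distrib]
    rw [Finset.sum_comm (s := range N) (t := Ico (n₀ + 1) p)]
  rw [show ∀ a b c d : ℚ, a + b - c - d = (a - c) + (b - d) from fun a b c d => by ring, hcirc, hhole]
  refine Valuation.map_add_le _ (Valuation.map_sum_le _ fun k₀ hk₀ => Valuation.map_sum_le _ fun K hK => ?_)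
    (Valuation.map_sum_le _ fun k₀ hk₀ => Valuation.map_sum_le _ fun K hK => ?_)
  · have hk₀' := mem_range.1 hk₀
    have hK' := mem_range.1 hK
    have hkn : k₀ + K * p ≤ n := by rw [hn_def]; nlinarith
    rw [map_mul]
    refine (mul_le_mul' (hg _ hkn) ?_).trans (by rw [one_mul])
    by_cases hc : 2 * (k₀ + K * p) ≠ n ∨ ε = 0
    · exact residueLaw_circ_zero hp2 hAB rfl rfl hN hn₀ (by omega) (by omega) hc
        (div_mul_cancel₀ _ (cTop_zero_ne_zero (by omega) A B))
    · have hε1 : ε = 1 := by omega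
      have hcen : 2 * (k₀ + K * p) = n := by by_contra h; exact hc (Or.inl h)
      subst hε1
      rw [cTop_one_centre A B hcen, zero_div, zero_mul, sub_zero]
      exact centre_cellZero_le hp2 hAB hn hkn hcen
  · have hk₀' := mem_Ico.1 hk₀
    have hK' := mem_range.1 hK
    obtain ⟨m, rfl⟩ : ∃ m, N = m + 1 := ⟨N - 1, by omega⟩
    rw [Nat.add_sub_cancel] at *
    have hm : m < p ^ (L + 1) := by omega
    have hkn : k₀ + K * p ≤ n := by rw [hn_def]; nlinarith
    by_cases hc : 2 * (k₀ + K * p) ≠ n ∨ ε = 0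
    · exact (hole_cellZero_le hp2 hAB hε hn₀ hm (by omega) (by omega) hk₀'.2 hc (hg _ hkn)).trans
        (exp_le_exp.2 (by omega))
    · have hε1 : ε = 1 := by omega
      have hcen : 2 * (k₀ + K * p) = n := by by_contra h; exact hc (Or.inl h)
      subst hε1
      rw [hn_def] at hcen
      rw [cTop_one_centre A B hcen, zero_div, mul_zero, zero_mul, sub_zero, map_mul]
      exact (mul_le_mul' (hg _ hkn) (centre_cellZero_le hp2 hAB hn hkn hcen)).trans (by rw [one_mul])

end reduction

end

end Summit.KontsevichZagierPeriods.Zeta5Search.BrickLevelReductionInf
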